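import Summits.CriticalPhenomena.PercolationContinuityZ3.Theorems.PercNearOneGluingNoHeavyLowerTailMajorityGluingTypeTable
import HarnessLib

/-!
# The 94-type table of the abstract `(4,3)` programme — the type classes of LEMMA J and THEOREM BOTTOM (definitions)
(lane prim-rate, constants-miner 1, gen 27; CLEAN-CERTIFICATES.md §3, §5, §8; census/g24/tools/lemmaJ.py, lemmaJ2.py,
propW3.py, propW5.py)

Support file for the closed crux `NoHeavyLowerTail` (stmt-CriticalPhenomena-4575), majority-gluing line; companion of
`…MajorityGluingTypeTable`.  The bookkeeping of CLEAN-CERTIFICATES §3–§8 (LEMMA B's control sets, LEMMA J's junk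
and supports, PROPOSITION W₄ / THEOREM BOTTOM's regime analysis) partitions the 79 non-inert types into CLASSES and
names a few distinguished types; this file defines them as computable predicates on `DType`:

* `K4` (all four relays one cut block), the twelve FAMILY types `s_z` (`{v_z}` cut, the other three attached in one
  block), `t_z` (`v_z` the only attached relay, the others one cut block), `q_z` (`{v_z}` and the other three: two cut
  blocks); `FACE′` = the 28 non-family types with exactly one cut block; `KK` = the 42 types with `≥ 2` cut blocks;
* `P = {e = +1}`, `Q = {e = −1}`; LEMMA B's control sets `CTRL₁ = Q`, `CTRL_z = {v_z cut, v₁ att, N ≤ 2} ∪ (Q ∩ {v_z cut})`;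
  the JUNK `J_z = S_z ∖ CTRL_z` (11 types per relay);
* the supports `π_{z¬y} = {v_z cut, v_z ≁ v_y}` (`= ρ_z^{0zy}`), the classes `KS_w = KK ∩ ⋃_{a,b ≠ w} π_{a¬b}` (41 types)
  and `J2_w` (the three `KK` types with cut blocks exactly `{v_w}` and a pair, the fourth relay attached) of THEOREM
  BOTTOM's regime B1, and «lies in a `w`-free hub triple».

The typewise facts about them ((J1)–(J7), (S2)–(S5), the profile identity `ρ_z^{1234} = 1[S_z] + 1[T_z]`, the class
sizes) are `decide`d in `…MajorityGluingTypeTableBottomFacts`; the law-level abbreviations `Km` (`K = x(KK)`), `Pim` (`π_{z¬y}(x)`),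
`Rho0` (`ρ₀^{0ab}(x)`) serve the THEOREM BOTTOM files.  Definitions only; no sorries.
[cite: VandenbergHaggstromKahn2005, Thm. 1.3 (p. 6)]
-/

namespace Summit.CriticalPhenomena.PercolationContinuityZ3.Theorems

namespace HubOnly
namespace TypeTable
namespace DType

variable (τ : DType)

/-- Number of blocks of `π`. -/
def nblocks : ℕ := (([1, 2, 3, 4].map fun x => τ.lab x).eraseDups).length

/-- Number of CUT blocks. -/
def ncutBlocks : ℕ := ((([1, 2, 3, 4].filter fun x => τ.cut x).map fun x => τ.lab x).eraseDups).length

/-- The type `K4 = 1234:1234`: all four relays glued into one cut block. -/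
def isK4 : Bool := τ.blkSize 1 == 4 && τ.cut 1

/-- Family type `s_z`: `{v_z}` a singleton cut block, the other three relays attached and in one block. -/
def isLs (z : ℕ) : Bool := τ.cut z && τ.blkSize z == 1 && τ.nblocks == 2 && τ.natt == 3

/-- Family type `t_z`: `v_z` the only attached relay, `{v_z}` its own block, the other three in one (cut) block. -/
def isLt (z : ℕ) : Bool := τ.att z && τ.blkSize z == 1 && τ.nblocks == 2 && τ.natt == 1

/-- Family type `q_z`: all relays cut, blocks `{v_z}` and `{the other three}`. -/
def isLq (z : ℕ) : Bool := τ.allCut && τ.blkSize z == 1 && τ.nblocks == 2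

/-- The twelve FAMILY types `s_z, t_z, q_z`. -/
def family : Bool := [1, 2, 3, 4].any fun z => τ.isLs z || τ.isLt z || τ.isLq z

/-- Class `KK`: at least two cut blocks. -/
def isKK : Bool := decide (2 ≤ τ.ncutBlocks)

/-- Class `FACE′`: exactly one cut block, not `K4`, not a family type. -/
def isFACE : Bool := τ.ncutBlocks == 1 && !τ.isK4 && !τ.family

/-- `P = {e = +1}` (= the layer `T₁`). -/
def isPos : Bool := τ.eZ == 1

/-- `Q = {e = −1}` (= `{v₁ cut, N ≤ 2}`). -/
def isNeg : Bool := τ.eZ == -1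

/-- LEMMA B's control sets: `CTRL₁ = Q`; `CTRL_z = {v_z cut, v₁ attached} ∖ P ∪ (Q ∩ {v_z cut})` for `z = 2,3,4`
(their mass is `≤ T_z − E` under the budget `B_z`). -/
def ctrl (z : ℕ) : Bool :=
  if z = 1 then τ.isNeg else (τ.cut z && τ.att 1 && !τ.isPos) || (τ.isNeg && τ.cut z)

/-- The JUNK of relay `z`: `J_z = S_z ∖ CTRL_z` (`J₁ = S₁ ∖ Q`; `J_z = (S_z ∩ P) ∪ (S_z ∩ {v₁ cut} ∖ Q)`). -/
def junk (z : ℕ) : Bool :=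
  if z = 1 then τ.isS 1 && !τ.isNeg else (τ.isS z && τ.isPos) || (τ.isS z && τ.cut 1 && !τ.isNeg)

/-- The support `π_{z¬y} = {v_z cut, v_z ≁ v_y}` (the relay support `ρ_z^{0zy}` of the hub triple `{a, v_z, v_y}`). -/
def piSupp (z y : ℕ) : Bool := τ.cut z && τ.sep z y

/-- `KS_w := KK ∩ ⋃_{a ≠ b, both ≠ w} π_{a¬b}` (THEOREM BOTTOM, regime B1). -/
def isKS (w : ℕ) : Bool :=
  τ.isKK && [1, 2, 3, 4].any fun a => [1, 2, 3, 4].any fun b => !(a == b) && !(a == w) && !(b == w) && τ.piSupp a b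

/-- `J2_w`: the `KK` types whose cut blocks are exactly `{v_w}` and a PAIR of the other relays (the fourth attached). -/
def isJ2 (w : ℕ) : Bool :=
  τ.ncutBlocks == 2 && τ.cut w && τ.blkSize w == 1 && τ.natt == 1 &&
    [1, 2, 3, 4].all fun z => z == w || τ.att z || τ.blkSize z == 2

/-- `τ` lies in a hub triple `u_{0ab}` avoiding the relay `w`. -/
def inWfreeHubTriple (w : ℕ) : Bool :=
  [1, 2, 3, 4].any fun a => [1, 2, 3, 4].any fun b => decide (a < b) && !(a == w) && !(b == w) && τ.uB [0, a, b]

/-- `τ` lies in some hub triple `u_{0ab}`. -/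
def inHubTriple : Bool := [1, 2, 3, 4].any fun a => [1, 2, 3, 4].any fun b => decide (a < b) && τ.uB [0, a, b]

end DType

/-! ### Law-level abbreviations used by THEOREM BOTTOM -/

noncomputable section

/-- Abbreviation: `K(x) = x(KK)`, the mass of the types with at least two cut blocks. -/
abbrev Km (x : DType → ℝ) : ℝ := lin (fun τ => DType.ind τ.isKK) x

/-- Abbreviation: the support mass `π_{z¬y}(x)`. -/
abbrev Pim (z y : ℕ) (x : DType → ℝ) : ℝ := lin (fun τ => DType.ind (τ.piSupp z y)) x

/-- Abbreviation: the hub support mass `ρ₀^{0ab}(x) = x(v_a, v_b cut)`. -/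
abbrev Rho0 (a b : ℕ) (x : DType → ℝ) : ℝ := lin (fun τ => DType.ind (τ.rho [0, a, b] 0)) x

end

end TypeTable
end HubOnly

end Summit.CriticalPhenomena.PercolationContinuityZ3.Theorems
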